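import Summits.ValiantsHypothesis.ValiantsHypothesis.Theses.ProofCarryingSymmetry
import Summits.ValiantsHypothesis.ValiantsHypothesis.Theorems.ProofCarryingSymmetryRestorationQPVpFamilyPiCircuit
import Summits.ValiantsHypothesis.ValiantsHypothesis.Theorems.ProofCarryingSymmetryRestorationQPACStabilityPF
import Summits.ValiantsHypothesis.ValiantsHypothesis.Theorems.ProofCarryingSymmetryRestorationQPPiCircuitVpFamily
import Summits.ValiantsHypothesis.ValiantsHypothesis.Theorems.ProofCarryingSymmetryRestorationQPDistStability
import Summits.ValiantsHypothesis.ValiantsHypothesis.Theorems.ProofCarryingSymmetryRestorationQPConsistency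
import Summits.ValiantsHypothesis.ValiantsHypothesis.Theorems.ProofCarryingSymmetryRestorationQPBudgetZero
import Summits.ValiantsHypothesis.ValiantsHypothesis.Theorems.ProofCarryingSymmetryRestorationQPPolylogWidth
import Summits.ValiantsHypothesis.ValiantsHypothesis.Theorems.ProofCarryingSymmetryRestorationQPDetProofCarrying
import Summits.ValiantsHypothesis.ValiantsHypothesis.Theorems.ProofCarryingSymmetryRestorationQPCoverStability
import Summits.ValiantsHypothesis.ValiantsHypothesis.Theorems.ProofCarryingSymmetryRestorationQPESatStability
import Summits.ValiantsHypothesis.ValiantsHypothesis.Theorems.ProofCarryingSymmetryRestorationQPESatInert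
import Literature.Computability.AlgebraicComplexity.PIProof

/-!
# Skeleton — crux `RestorationQP` (item `stmt-ValiantsHypothesis-10343`), line `registered` (birth, reshaped by the lead)

Route `route-ValiantsHypothesis-ProofCarryingSymmetry`, crux
`Summit.ValiantsHypothesis.ValiantsHypothesis.Theses.ProofCarryingSymmetry.RestorationQP`
(symmetry restoration at quasi-polynomial total cost for diagonally `S_n`-invariant VP families).

The line is the route's own layer-2 split RESTORATION ⇐ PROVABILITY (T_gen) ∘ STABILITY (L), typed over
`Literature.Computability.AlgebraicComplexity.PIProof` (Hrubeš–Tzameret `P_c(ℂ)`). The lead's reshape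
(cycle 1) splits each of the two birth stubs once, isolating the PROVABLE rung of each:

* T_gen = `stub_vpFamily_piCircuit` (W1, provable: a VP family has polynomial-size HT circuits
  `PICircuit` — conversion from the tree's fan-in-two `ArithCircuit`/`complexity`) followed by
  `stub_invarianceProvableQP'` (T′, conjecture-grade: a polynomial-size `PICircuit` family computing a
  diagonally invariant family can be replaced by a quasi-polynomial one all of whose invariance
  identities `C ∘ σ = C` have quasi-polynomial `P_c(ℂ)`-proofs). Glue `invarianceProvableQP_of`.
* L = `stub_proofsToACEquiv` (S2″, the route's bet in sharpened form: size-`t` proofs of all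
  invariance identities of `C` ⇒ a circuit `C'` for the same polynomial, of size polynomial in
  `|C| + t + n`, whose UNFOLDINGS `(C' ∘ σ)•`, `C'•` are inter-derivable in `P_f` WITHOUT A6–A10, i.e.
  equal modulo associativity and commutativity) followed by `stub_stabilityAtACEquiv` (S3″, PROVED by
  the lead: such AC-invariance for every `σ` ⇒ an `S_n`-symmetric labelled circuit of size polynomial
  in `|C| + n` — the precise, presentation-independent form of the route's dictum "zero proof length =
  Dawar–Wilsenach's syntactic symmetry"). Glue `stabilityOfProvableSymmetry_of`.  (Cycle-1 history: the
  first reshape used A6–A10-free `P_c` proofs between the presentations `C' ∘ σ` and `C'` — stubs S2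
  `stub_proofsToACInvariance` / S3 `stub_stabilityAtACBudget`; S3 is proved and landed
  (`Theorems.…ACCircuitEval`), but that hypothesis is sensitive to the dead weight of straight-line
  presentations, so the bet was re-typed over unfoldings: S2″ is implied by S2, S3″ implies S3.)
* `RestorationQP_of : T′ → S2″ → S3″ → RestorationQP` (W1 discharged inside), through the birth
  composition (`qp_absorb`), kernel-checked; the final `example` wires the sorried stubs into it.

Why this reshape is honest (ALL PROVED): S2″ ∧ S3″ ⇒ L is the glue below, and conversely L ⇒ S2″ is
`Theorems.proofsToACEquiv_of_stabilityOfProvableSymmetry` (`…RestorationQPACConverse`: a symmetric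
labelled circuit lays out as a straight-line `PICircuit` of size `≤ |G|²(|G|+2)` whose renamed unfoldings
are AC-equivalent to its unfolding, `ACStability.exists_piCircuit_of_isSymmetric`), so the bet S2″ is
EQUIVALENT to the route's stability statement L, but is now a pure PROOF-NORMALISATION statement:
"distributivity, unit and constant axioms can be eliminated from invariance proofs at polynomial cost
in the circuit, up to AC of the unfolding".  NECESSITY: the crux itself implies the joint conclusion of
T′ and S2″ — quasi-polynomial `PICircuit`s symmetric up to AC (`Theorems.acInvariantQP_of_restorationQP`).
Budget-0 is metered with the tree's axiom-metered provability `PISystem.Provable (pfSystem ℂ _) F G ⊤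
budget` (budget `0` on A6–A10, `⊤` elsewhere, written inline; = `ACStability.ACEq` by
`acEq_iff_pfProvable`).

CYCLE 2 (lead c2) — NECESSITY OF THE PROVABILITY STUB, PROVED: `RestorationQP → InvarianceProvableQP`
(T_gen = W1 ∘ T′; `Theorems.invarianceProvableQP_of_restorationQP`, file …RestorationQPProvabilityNecessity,
on top of `PCR.exists_piCircuit_pcProofs_of_isSymmetric`, files …RestorationQPPC{Realizable,CombCalculus,
CombPerm,DeadWeight,LayoutSteps,LayoutComb,LayoutIso} + …LayoutNodes): an `S_n`-symmetric Dawar–Wilsenach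
circuit on `G` gates, laid out as a straight-line `PICircuit` of size `≤ |G|²(|G|+2)`, PROVES ITS OWN
SYMMETRY in `P_c(ℂ)` — every invariance identity `C ∘ σ = C` has a proof of size `≤ 310·(|G|+3)⁹`
(gate-by-gate simulation of the automorphism as ONE proof DAG: C1/C2 unsharing of the combs, pointwise
congruence with the children's lines, associativity–commutativity sorting of the comb by the permutation
relating the two enumerations of `children (π g) = π(children g)`, and Hrubeš–Tzameret dead-weight
elimination `F_{i-1} + ℓ = F_{i-1} + F_i ⊢ F_i = ℓ` at the leaves — the one place where A6–A10 are
needed, dead weight being rigid in the AC fragment).  Hence the provability stub is SANDWICHED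
(`invarianceProvableQP_necessary` below: crux ⇒ T_gen; `restorationQP_of_T_L`: T_gen ∧ L ⇒ crux), T′ ⟺
T_gen (W1 and W1⁻¹ `Theorems.isVPFamily_of_piCircuits` both landed; `stub_invarianceProvableQP'_necessary`
below: crux ⇒ T′ verbatim; T′ also follows from quasi-polynomial boundedness of `P_c`,
`Theorems.invarianceProvableQP'_of_pcQuasipolyBounded`), and the line's only content beyond proven
consequences of the crux is the stability bet.  THIRD RESHAPE (worker A, cycle 2): the bet is
weakened from S2″ (no A6–A10) to S2⁗ `stub_proofsToDistEquiv` (no A6 only: units A7–A9 and constants A10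
allowed), sufficient by the PROVED S3⁗ `stub_stabilityAtDistEquiv` (`Theorems.stabilityAtDistEquiv`,
p157844: unit/constant-normalised AC-canonical symmetric circuit, size ≤ (|C|+n+2)^6) and still ≡ L
(`proofsToACEquiv_of_dist`: S2⁗ ⇒ S2″).  Composition now `RestorationQP_of : T′ → S2⁗ → RestorationQP`.

CYCLE 3 (lead c3) — THE CONSISTENCY MAP IS CLOSED: the registered bet S2⁗ (and L) is IMPLIED by UNIFORM polynomial
symmetry restoration UR (one exponent `c` such that every straight-line circuit `C` over `ℂ` computing a diagonally
invariant polynomial has an `S_n`-symmetric labelled circuit of size `≤ (|C| + n + 2)^c`; proofs are forgotten by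
soundness) — `Theorems.proofsToDistEquiv_of_uniformRestoration` (p162012), with `Theorems.restorationQP_of_uniformRestoration`
(UR ⇒ crux, via W1) and the contrapositive `Theorems.not_uniformRestoration_of_not_proofsToDistEquiv`.  Hence every
statement of this line is sandwiched: UR ⇒ {crux ⇒ T′, S2⁗ ⟺ L} and T′ ∧ S2⁗ ⇒ crux (⇒ VP ≠ VNP through the proved
`SquareSymmetricPermLB` and `Assembly`).  A disprover can kill either open stub only with an "arithmetic CFI" family
(invariant polynomials whose symmetric complexity is super-polynomial in their circuit complexity; Dwivedi–Pago–Seppelt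
2026 Outlook Q3, open), and a prover can close either only by a restoration-strength theorem.  Glue below:
`stub_proofsToDistEquiv_of_uniformRestoration`, `restorationQP_of_uniformRestoration'`.
NEGATIVE SIDE (cycle 3, all landed): `Theorems/RestorationQP/Negative/RestorationQPFalseOfArithmeticCFI.lean` (p162481,
`--negative-modulo ArithmeticCFI`: `RestorationQP_false_of_ArithmeticCFI`, engine `eval_adj_eq_eventually_of_isSymmetric_subexp`
= Dawar–Wilsenach Thm 5.1 + Thm 6.4 for any polynomial family; `ArithmeticCFI` is now a construction item),
`Theorems.…RestorationQPBetNegative` (p162837: a `2^{o(n)}` proof-carrying separating family kills L and S2⁗),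
`Theorems.…RestorationQPArithmeticCFIDichotomy` (p162999: `arithmeticCFI_or_valiantsHypothesis`, UNCONDITIONAL — per ∈ VP makes
the permanent an arithmetic CFI family by DW Thm 7.2), and the line's composition importable at Theorems level,
`Theorems.restorationQP_of_invarianceProvableQP'_of_proofsToDistEquiv : T′ → S2⁗ → RestorationQP` (p163213, with
`S2⁗ → (RestorationQP ↔ T′)` and `ArithmeticCFI → S2⁗ → ¬T′`).

CYCLE 4 (lead c4) — RUNGS AND INSTRUMENTS (both registered stubs untouched, still conjecture-grade):
(i) `Theorems.proofCarryingSymmetry_at_distBudgetZero` (p166162): at distributivity budget `t = 0` the WHOLE line is a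
theorem — restoration AND a poly-size proof-carrying circuit (AC-invariant unfoldings + `P_c` invariance proofs), one
bound `(|C|+n+2)^72`; so all open content of T′ and S2⁗ sits at `t ≥ 1` (glue `line_at_distBudgetZero` below).
(ii) `Theorems.det_proofCarryingSymmetry` (p165838): det passes both dials at POLYNOMIAL cost (size `(n+2)^13`, proofs
`(n+2)^54`).  (iii) `Theorems.…RestorationQPPolylogWidth` (p166528): crux ⇒ WIDTH LAW (every invariant VP family has
polylog counting width uniformly in `n`, `widthLawVP_of_restorationQP`); ONE invariant VP family separating one
`≡^{C^{(log₂n+c')^{c'}}}`-pair per level `c'` kills the crux (`RestorationQP_false_of_polylogWidthVP`, the kill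
criterion at the right scale; c3's `ArithmeticCFI` is a special case); the width law alone gives VH
(`valiantsHypothesis_of_widthLawVP` — a strictly thinner sufficient crux, planner hint); the same at polylog scale for
the bet (`proofsToDistEquiv_false_of_polylogProofCarrying`).  (iv) Mechanism proposed for the graded bet S3^(t):
COSET COVERING — Church–Rosser for `t` ground distributivity instances (OPEN, the genuine content of S3^(1)) ∘
B. H. Neumann's coset-covering lemma (`Theorems.exists_index_le_of_saturation_cover`, p166697, LANDED) ∘ induction of
symmetric circuits from a finite-index subgroup (`Theorems.CosetInduction.*`, p167230 + sequel) ∘ the S3″ engine;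
predicted size `poly(|C|)·|R|^{2t}`, the polynomial-in-`(|C|+t+n)` shape of L.  See Cruxes/RestorationQP/CYCLE4-REPORT.md.

PLANNER POINTERS (all landed under Theorems/ProofCarryingSymmetry…): `invarianceProvableQP'_of_restorationQP`
(crux ⇒ T′), `stabilityOfProvableSymmetry_iff_proofsToDistEquiv` (L ⟺ S2⁗ — two typed forms for item
stmt-10358), `perInvarianceProvableQP_of_restorationQP` (crux ⇒ T_per, stmt-10360),
`valiantsHypothesis_of_perLine[_dist]` (ANCHOR ∧ T_per ∧ L/S2⁗ ⇒ VH — the route's foreseen edit (a),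
kernel-checked), `hasPCProofOfSize_of_unfold_eq` (HT Remark 1.3 for the tree's `P_c`: presentation
independence of T′ up to a polynomial; fails without A6–A10).

Disproof used: none exists for this crux (`ledger crux ls`: no `Disproof.lean`, no `Negative/*`).

Cycle 5 (lead c5): RUNG S3^(1)-inv LANDED — stability at distributivity budget ONE for one S_n-invariant generic
ground instance (`rung_distOne_invariantGeneric` = `Theorems.stabilityAtDistOne_invariantGeneric`), by a SEMANTIC
Church–Rosser theorem for one generic ground distributivity instance (`Theorems.esat_acEq_of_ucEqWith`: the
e-saturation `ACStability.esat` — smart sums, PEELED smart products removing complete copies of the pattern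
`(factors of cnorm P) ⊎ {cnorm(Q+R)}` and inserting the expansion `cnorm(PQ+PR)` — respects `UCEqWith e`; no
termination/confluence argument), equivariance, and the AC-canonical circuit of the saturated class.  Stubs landed by
name: esat_kmax_spec, esat_removeBy_spec, esat_ucEq_cnorm, esat_nvars_cnorm_le, esat_rename (wave 1), esat_eval,
esat_acEq_of_pieces, esat_card_reach, esat_card_kids (wave 2), esat_acEq_of_ucEqWith, stabilityAtDistOne_invariantGeneric
(lead).  CORE(1) in general stays open: the naive cover lemma "σT ≡_e T ⇒ σ ∈ Stab T ∪ Stab Φ_e T" is FALSE (twisted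
example, CYCLE5-REPORT.md §3); untwisted σ are exactly this rung.  The registered conjecture-grade stubs T′, S2⁗ are
unchanged.
-/

set_option linter.dupNamespace false

namespace Summit.ValiantsHypothesis.ValiantsHypothesis.Cruxes.RestorationQP.Birth

open Summit.ValiantsHypothesis.ValiantsHypothesis.Theses.ProofCarryingSymmetry
open Literature.Computability.AlgebraicComplexity

/-! ## The two birth stub statements (kept verbatim; now DERIVED from the four registered stubs) -/

/-- **T_gen — PROVABILITY OF INVARIANCE AT QUASI-POLYNOMIAL COST** (birth stub statement):
every diagonally `S_n`-invariant VP family has quasi-polynomial fan-in-2 circuits whose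
invariance identities `C ∘ σ = C`, `σ ∈ S_n`, all have quasi-polynomial `P_c(ℂ)`-proofs.
[conjecture-grade: HrubesTzameret2009 §1, arXiv:1112.6265 §1.1] -/
def InvarianceProvableQP : Prop :=
  ∀ f : (n : ℕ) → MvPolynomial (Fin n × Fin n) ℂ,
    (∀ (n : ℕ) (σ : Equiv.Perm (Fin n)),
      MvPolynomial.rename (fun x : Fin n × Fin n => σ • x) (f n) = f n) →
    IsVPFamily f →
    ∃ c : ℕ, ∀ n : ℕ, ∃ C : PICircuit ℂ (Fin n × Fin n),
      C.eval = f n ∧ C.size ≤ 2 ^ ((Nat.log 2 n + c) ^ c) ∧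
      ∀ σ : Equiv.Perm (Fin n),
        HasPCProofOfSize (C.rename fun x : Fin n × Fin n => σ • x) C (2 ^ ((Nat.log 2 n + c) ^ c))

/-- **L — STABILITY OF PROVABLE SYMMETRY** (birth stub statement; the route's bet): short
`P_c(ℂ)`-proofs of all invariance identities of a circuit `C` yield a genuinely `S_n`-symmetric
labelled circuit computing `Ĉ` of size polynomial in `|C| + t + n`.
[conjecture-grade: DawarWilsenach2025 Def. 3.7, DeChiffreGlebskyLubotzkyThom2017] -/
def StabilityOfProvableSymmetry : Prop :=
  ∃ c : ℕ, ∀ (n t : ℕ) (C : PICircuit ℂ (Fin n × Fin n)),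
    (∀ σ : Equiv.Perm (Fin n),
      HasPCProofOfSize (C.rename fun x : Fin n × Fin n => σ • x) C t) →
    ∃ (G : Type) (_ : Fintype G) (D : LabelledArithCircuit ℂ (Fin n × Fin n) Unit G),
      D.IsSymmetric (Equiv.Perm (Fin n)) ∧ D.eval (D.output ()) = C.eval ∧
      Fintype.card G ≤ (C.size + t + n + 2) ^ c

/-! ## The registered stubs (W1, S3″, S3⁗ landed; T′ open and proven necessary; S2⁗ open — the bet) -/

/-- Stub W1 (registered; LANDED p145664, wave 1): **a VP family has polynomial-size Hrubeš–Tzameret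
circuits.** The tree's `IsVPFamily` bounds the total degree and the fan-in-two straight-line complexity
`complexity` (Bürgisser's `L`, weighted sums allowed) polynomially; a fan-in-two `ArithCircuit`
becomes a `PICircuit` with `≤ 9` nodes per gate
(`Theorems.ProofCarryingSymmetryRestorationQPVpFamilyPiCircuit`, `VpFamilyPiCircuit.toPICircuit`).
[folklore: Burgisser2000 Def. 2.1; HrubesTzameret2015 §1.1] -/
theorem stub_vpFamily_piCircuit :
    ∀ f : (n : ℕ) → MvPolynomial (Fin n × Fin n) ℂ, IsVPFamily f →
      ∃ c : ℕ, ∀ n : ℕ, (f n).totalDegree ≤ (n + 2) ^ c ∧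
        ∃ C : PICircuit ℂ (Fin n × Fin n), C.eval = f n ∧ C.size ≤ (n + 2) ^ c :=
  Summit.ValiantsHypothesis.ValiantsHypothesis.Theorems.stub_vpFamily_piCircuit

/-- Stub T′ (registered; conjecture-grade): **provability of invariance at quasi-polynomial cost
for polynomial-size circuit families** — a diagonally `S_n`-invariant family of polynomial degree
computed by polynomial-size `PICircuit`s has quasi-polynomial-size circuits all of whose invariance
identities have quasi-polynomial `P_c(ℂ)`-proofs. T_gen = W1 ∘ T′.  NECESSARY (cycle 2): the crux
implies T_gen (`invarianceProvableQP_necessary`); SUFFICIENT condition: quasi-polynomial boundedness of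
`P_c(ℂ)` on pairs of equivalent circuits (`Theorems.invarianceProvableQP'_of_pcQuasipolyBounded`).
[conjecture-grade: HrubesTzameret2009 §1 (p-boundedness of `P_c` open), arXiv:1112.6265 §1.1] -/
theorem stub_invarianceProvableQP' :
    ∀ f : (n : ℕ) → MvPolynomial (Fin n × Fin n) ℂ,
      (∀ (n : ℕ) (σ : Equiv.Perm (Fin n)),
        MvPolynomial.rename (fun x : Fin n × Fin n => σ • x) (f n) = f n) →
      (∃ c : ℕ, ∀ n : ℕ, (f n).totalDegree ≤ (n + 2) ^ c ∧
        ∃ C : PICircuit ℂ (Fin n × Fin n), C.eval = f n ∧ C.size ≤ (n + 2) ^ c) →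
      ∃ c : ℕ, ∀ n : ℕ, ∃ C : PICircuit ℂ (Fin n × Fin n),
        C.eval = f n ∧ C.size ≤ 2 ^ ((Nat.log 2 n + c) ^ c) ∧
        ∀ σ : Equiv.Perm (Fin n),
          HasPCProofOfSize (C.rename fun x : Fin n × Fin n => σ • x) C
            (2 ^ ((Nat.log 2 n + c) ^ c)) := by
  sorry

/-- Stub S2⁗ (registered, cycle 2 — THE BET, third reshape: distributivity elimination): **proofs of
invariance can be traded for a circuit that is invariant up to associativity, commutativity, units and
constants.** If all invariance identities `C ∘ σ = C` have `P_c(ℂ)`-proofs of size `≤ t`, some circuit `C'`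
computing `Ĉ`, of size polynomial in `|C| + t + n`, has, for every `σ`, its UNFOLDINGS `(C' ∘ σ)•` and `C'•`
inter-derivable in `P_f(ℂ)` with NO instance of A6 (distributivity) — A1–A5, the unit laws A7–A9 and the
constant equations A10 all allowed.  Weaker than S2″ (budget 0 on A6 only instead of A6–A10); still
sufficient by S3⁗ (`stub_stabilityAtDistEquiv`, PROVED by worker A, cycle 2); still EQUIVALENT to the
birth stub L (L ⇒ S2″ ⇒ S2⁗ ⇒ L).  The bet is now literally "distributivity can be eliminated from
invariance proofs at polynomial cost in the circuit".
[conjecture-grade: Ulam/Kazhdan-type stability on the `P_c` rewrite graph;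
DeChiffreGlebskyLubotzkyThom2017, DawarWilsenach2025 Def. 3.7] -/
theorem stub_proofsToDistEquiv :
    ∃ c : ℕ, ∀ (n t : ℕ) (C : PICircuit ℂ (Fin n × Fin n)),
      (∀ σ : Equiv.Perm (Fin n),
        HasPCProofOfSize (C.rename fun x : Fin n × Fin n => σ • x) C t) →
      ∃ C' : PICircuit ℂ (Fin n × Fin n), C'.eval = C.eval ∧
        C'.size ≤ (C.size + t + n + 2) ^ c ∧
        ∀ σ : Equiv.Perm (Fin n),
          (pfSystem ℂ (Fin n × Fin n)).Provable (C'.rename fun x : Fin n × Fin n => σ • x).unfold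
            C'.unfold ⊤ (fun s => if s = PIAxiom.A6 then 0 else ⊤) := by
  sorry

/-- Stub S3⁗ (registered; PROVED and LANDED by worker A, cycle 2, `Theorems.stabilityAtDistEquiv`,
p157844 — stability at DISTRIBUTIVITY budget zero): if for every `σ ∈ S_n` the unfoldings `(C ∘ σ)•` and
`C•` are inter-derivable in `P_f(ℂ)` without A6 (units and constants allowed), then the AC-canonical
circuit of the unit/constant-normalised unfolding is an `S_n`-symmetric labelled circuit computing `Ĉ` of
size `≤ (|C| + n + 2)^6` (normaliser `cnorm`: shape-preserving constant folding and unit removal, then the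
cycle-1 `acCircuit` pipeline; files …RestorationQP{DistEq,ACSums,ConstNorm,ConstNormNF,ConstNormAC,
ConstNormSubs,DistStability}). [folklore: DawarWilsenach2025 Def. 3.7; HrubesTzameret2015 §1.1] -/
theorem stub_stabilityAtDistEquiv :
    ∃ c : ℕ, ∀ (n : ℕ) (C : PICircuit ℂ (Fin n × Fin n)),
      (∀ σ : Equiv.Perm (Fin n),
        (pfSystem ℂ (Fin n × Fin n)).Provable (C.rename fun x : Fin n × Fin n => σ • x).unfold
          C.unfold ⊤ (fun s => if s = PIAxiom.A6 then 0 else ⊤)) →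
      ∃ (G : Type) (_ : Fintype G) (D : LabelledArithCircuit ℂ (Fin n × Fin n) Unit G),
        D.IsSymmetric (Equiv.Perm (Fin n)) ∧ D.eval (D.output ()) = C.eval ∧
        Fintype.card G ≤ (C.size + n + 2) ^ c :=
  Summit.ValiantsHypothesis.ValiantsHypothesis.Theorems.stabilityAtDistEquiv

/-- Stub S3″ (registered; PROVED and LANDED by the lead, `Theorems.ProofCarryingSymmetryRestorationQPACStabilityPF`,
p149435 — "zero proof length = syntactic symmetry", presentation-robust form): **stability at
distributivity budget zero.** If for every `σ ∈ S_n` the unfoldings `(C ∘ σ)•` and `C•` are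
inter-derivable in `P_f(ℂ)` using only A1–A5 and the rules, then the associative-commutative canonical
form of `C` is `S_n`-stable and IS an `S_n`-symmetric labelled circuit (Dawar–Wilsenach Def. 3.7)
computing `Ĉ`, of size polynomial in `|C| + n` (gates: the AC-classes of flattened subterms reachable
from `⟦C•⟧`, `≤ |C| + 1` of them, plus binary doubling chains for multiplicities; `c = 4`).  The first
version S3 (`stub_stabilityAtACBudget`, A6–A10-free `P_c` proofs as hypothesis — a stronger hypothesis)
is landed as well (`Theorems.…ACCircuitEval`). [folklore: DawarWilsenach2025 Def. 3.7;
HrubesTzameret2015 §1.1] -/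
theorem stub_stabilityAtACEquiv :
    ∃ c : ℕ, ∀ (n : ℕ) (C : PICircuit ℂ (Fin n × Fin n)),
      (∀ σ : Equiv.Perm (Fin n),
        (pfSystem ℂ (Fin n × Fin n)).Provable (C.rename fun x : Fin n × Fin n => σ • x).unfold
          C.unfold ⊤
          (fun s => if s = PIAxiom.A6 ∨ s = PIAxiom.A7 ∨ s = PIAxiom.A8 ∨
            s = PIAxiom.A9 ∨ s = PIAxiom.A10 then 0 else ⊤)) →
      ∃ (G : Type) (_ : Fintype G) (D : LabelledArithCircuit ℂ (Fin n × Fin n) Unit G),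
        D.IsSymmetric (Equiv.Perm (Fin n)) ∧ D.eval (D.output ()) = C.eval ∧
        Fintype.card G ≤ (C.size + n + 2) ^ c :=
  Summit.ValiantsHypothesis.ValiantsHypothesis.Theorems.stub_stabilityAtACEquiv

/-! ## Name-keyed aliases of the stub statements (hypotheses of the composition) -/
namespace Registered

/-- Alias: the signature of `stub_vpFamily_piCircuit` (W1). -/
abbrev stub_vpFamily_piCircuit : Prop :=
  ∀ f : (n : ℕ) → MvPolynomial (Fin n × Fin n) ℂ, IsVPFamily f →
    ∃ c : ℕ, ∀ n : ℕ, (f n).totalDegree ≤ (n + 2) ^ c ∧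
      ∃ C : PICircuit ℂ (Fin n × Fin n), C.eval = f n ∧ C.size ≤ (n + 2) ^ c

/-- Alias: the signature of `stub_invarianceProvableQP'` (T′). -/
abbrev stub_invarianceProvableQP' : Prop :=
  ∀ f : (n : ℕ) → MvPolynomial (Fin n × Fin n) ℂ,
    (∀ (n : ℕ) (σ : Equiv.Perm (Fin n)),
      MvPolynomial.rename (fun x : Fin n × Fin n => σ • x) (f n) = f n) →
    (∃ c : ℕ, ∀ n : ℕ, (f n).totalDegree ≤ (n + 2) ^ c ∧
      ∃ C : PICircuit ℂ (Fin n × Fin n), C.eval = f n ∧ C.size ≤ (n + 2) ^ c) →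
    ∃ c : ℕ, ∀ n : ℕ, ∃ C : PICircuit ℂ (Fin n × Fin n),
      C.eval = f n ∧ C.size ≤ 2 ^ ((Nat.log 2 n + c) ^ c) ∧
      ∀ σ : Equiv.Perm (Fin n),
        HasPCProofOfSize (C.rename fun x : Fin n × Fin n => σ • x) C (2 ^ ((Nat.log 2 n + c) ^ c))

/-- Alias: the signature of the cycle-1 bet S2″ `stub_proofsToACEquiv` (now DERIVED from S2⁗,
`proofsToACEquiv_of_dist`). -/
abbrev stub_proofsToACEquiv : Prop :=
  ∃ c : ℕ, ∀ (n t : ℕ) (C : PICircuit ℂ (Fin n × Fin n)),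
    (∀ σ : Equiv.Perm (Fin n),
      HasPCProofOfSize (C.rename fun x : Fin n × Fin n => σ • x) C t) →
    ∃ C' : PICircuit ℂ (Fin n × Fin n), C'.eval = C.eval ∧
      C'.size ≤ (C.size + t + n + 2) ^ c ∧
      ∀ σ : Equiv.Perm (Fin n),
        (pfSystem ℂ (Fin n × Fin n)).Provable (C'.rename fun x : Fin n × Fin n => σ • x).unfold
          C'.unfold ⊤
          (fun s => if s = PIAxiom.A6 ∨ s = PIAxiom.A7 ∨ s = PIAxiom.A8 ∨
            s = PIAxiom.A9 ∨ s = PIAxiom.A10 then 0 else ⊤)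

/-- Alias: the signature of `stub_proofsToDistEquiv` (S2⁗, the registered bet since cycle 2). -/
abbrev stub_proofsToDistEquiv : Prop :=
  ∃ c : ℕ, ∀ (n t : ℕ) (C : PICircuit ℂ (Fin n × Fin n)),
    (∀ σ : Equiv.Perm (Fin n),
      HasPCProofOfSize (C.rename fun x : Fin n × Fin n => σ • x) C t) →
    ∃ C' : PICircuit ℂ (Fin n × Fin n), C'.eval = C.eval ∧
      C'.size ≤ (C.size + t + n + 2) ^ c ∧
      ∀ σ : Equiv.Perm (Fin n),
        (pfSystem ℂ (Fin n × Fin n)).Provable (C'.rename fun x : Fin n × Fin n => σ • x).unfold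
          C'.unfold ⊤ (fun s => if s = PIAxiom.A6 then 0 else ⊤)

/-- Alias: the signature of `stub_stabilityAtDistEquiv` (S3⁗, landed p157844). -/
abbrev stub_stabilityAtDistEquiv : Prop :=
  ∃ c : ℕ, ∀ (n : ℕ) (C : PICircuit ℂ (Fin n × Fin n)),
    (∀ σ : Equiv.Perm (Fin n),
      (pfSystem ℂ (Fin n × Fin n)).Provable (C.rename fun x : Fin n × Fin n => σ • x).unfold
        C.unfold ⊤ (fun s => if s = PIAxiom.A6 then 0 else ⊤)) →
    ∃ (G : Type) (_ : Fintype G) (D : LabelledArithCircuit ℂ (Fin n × Fin n) Unit G),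
      D.IsSymmetric (Equiv.Perm (Fin n)) ∧ D.eval (D.output ()) = C.eval ∧
      Fintype.card G ≤ (C.size + n + 2) ^ c

/-- Alias: the signature of `stub_stabilityAtACEquiv` (S3″). -/
abbrev stub_stabilityAtACEquiv : Prop :=
  ∃ c : ℕ, ∀ (n : ℕ) (C : PICircuit ℂ (Fin n × Fin n)),
    (∀ σ : Equiv.Perm (Fin n),
      (pfSystem ℂ (Fin n × Fin n)).Provable (C.rename fun x : Fin n × Fin n => σ • x).unfold
        C.unfold ⊤
        (fun s => if s = PIAxiom.A6 ∨ s = PIAxiom.A7 ∨ s = PIAxiom.A8 ∨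
          s = PIAxiom.A9 ∨ s = PIAxiom.A10 then 0 else ⊤)) →
    ∃ (G : Type) (_ : Fintype G) (D : LabelledArithCircuit ℂ (Fin n × Fin n) Unit G),
      D.IsSymmetric (Equiv.Perm (Fin n)) ∧ D.eval (D.output ()) = C.eval ∧
      Fintype.card G ≤ (C.size + n + 2) ^ c

end Registered

/-! ## Glue (kernel-checked) -/

/-- **T_gen = W1 ∘ T′**: a VP family has polynomial-size `PICircuit`s (W1), to which T′ applies.
[folklore] -/
theorem invarianceProvableQP_of :
    Registered.stub_vpFamily_piCircuit → Registered.stub_invarianceProvableQP' →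
      InvarianceProvableQP :=
  fun hW hT f hinv hVP => hT f hinv (hW f hVP)

/-- **Necessity of the provability stub (cycle 2, PROVED)**: the crux implies T_gen — the
`S_n`-symmetric circuits it supplies, laid out as straight-line programs, prove their own invariance
identities in `P_c(ℂ)` in polynomial size (`Theorems.invarianceProvableQP_of_restorationQP`).
[folklore] -/
theorem invarianceProvableQP_necessary : RestorationQP → InvarianceProvableQP :=
  fun h => Summit.ValiantsHypothesis.ValiantsHypothesis.Theorems.invarianceProvableQP_of_restorationQP h

/-- **Necessity of the REGISTERED stub T′ itself (cycle 2, PROVED)**: with W1⁻¹ (a family with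
polynomial-size `PICircuit`s and polynomial degree is a VP family, `Theorems.isVPFamily_of_piCircuits`,
worker B2) the crux implies `stub_invarianceProvableQP'` verbatim
(`Theorems.invarianceProvableQP'_of_restorationQP`).  So T′ ⟺ T_gen, and of the two open stubs one is
a proven consequence of the crux and the other (S2″) is equivalent to the route's bet L. [folklore] -/
theorem stub_invarianceProvableQP'_necessary : RestorationQP → Registered.stub_invarianceProvableQP' :=
  fun h => Summit.ValiantsHypothesis.ValiantsHypothesis.Theorems.invarianceProvableQP'_of_restorationQP h

/-- **Uniform polynomial restoration** (UR; NOT a route item — the natural strengthening of the crux against which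
the bet is calibrated, cycle 3): one exponent `c` such that every straight-line circuit over `ℂ` computing a
diagonally `S_n`-invariant polynomial has an `S_n`-symmetric labelled circuit with at most `(|C| + n + 2)^c` gates.
[conjecture-grade: DwivediPagoSeppelt2026 Outlook Q3 (uniform, polynomial form)] -/
def UniformRestorationP : Prop :=
  ∃ c : ℕ, ∀ (n : ℕ) (C : PICircuit ℂ (Fin n × Fin n)),
    (∀ σ : Equiv.Perm (Fin n),
      MvPolynomial.rename (fun x : Fin n × Fin n => σ • x) C.eval = C.eval) →
    ∃ (G : Type) (_ : Fintype G) (D : LabelledArithCircuit ℂ (Fin n × Fin n) Unit G),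
      D.IsSymmetric (Equiv.Perm (Fin n)) ∧ D.eval (D.output ()) = C.eval ∧
      Fintype.card G ≤ (C.size + n + 2) ^ c

/-- **UR ⇒ S2⁗ (cycle 3, PROVED, p162012)**: the registered bet is implied by uniform polynomial restoration
(`Theorems.proofsToDistEquiv_of_uniformRestoration`: forget the proofs by soundness, lay the symmetric circuit out,
B-core″).  Contrapositive: refuting the bet requires an arithmetic-CFI family. [folklore] -/
theorem stub_proofsToDistEquiv_of_uniformRestoration :
    UniformRestorationP → Registered.stub_proofsToDistEquiv :=
  fun h => Summit.ValiantsHypothesis.ValiantsHypothesis.Theorems.proofsToDistEquiv_of_uniformRestoration h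

/-- **UR ⇒ the crux (cycle 3, PROVED, p162012)**: uniform polynomial restoration is a strengthening of
`RestorationQP` (W1 supplies the polynomial-size circuits). Together with `stub_invarianceProvableQP'_necessary`
(crux ⇒ T′) this sandwiches both open stubs between UR and the crux. [folklore] -/
theorem restorationQP_of_uniformRestoration' : UniformRestorationP → RestorationQP :=
  fun h => Summit.ValiantsHypothesis.ValiantsHypothesis.Theorems.restorationQP_of_uniformRestoration h

/-- **UR ⇒ T′ (cycle 3)**: through the crux. [folklore] -/
theorem stub_invarianceProvableQP'_of_uniformRestoration :
    UniformRestorationP → Registered.stub_invarianceProvableQP' :=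
  fun h => stub_invarianceProvableQP'_necessary (restorationQP_of_uniformRestoration' h)

/-- Polynomial bookkeeping of `L = S2 ∘ S3`: `((m ^ c₂) + n + 2) ^ c₃ ≤ m ^ ((c₂ + 2) * c₃)` for
`m = s + t + n + 2` with `1 ≤ s`. [folklore] -/
theorem poly_absorb (c₂ c₃ s t n : ℕ) (hs : 1 ≤ s) :
    ((s + t + n + 2) ^ c₂ + n + 2) ^ c₃ ≤ (s + t + n + 2) ^ ((c₂ + 2) * c₃) := by
  set m : ℕ := s + t + n + 2 with hm
  have hm2 : 2 ≤ m := by omega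
  have h1 : m ^ c₂ + n + 2 ≤ m ^ (c₂ + 2) := by
    have hA : 1 ≤ m ^ c₂ := Nat.one_le_pow _ _ (by omega)
    have hB : n + 2 ≤ m := by omega
    calc m ^ c₂ + n + 2 ≤ m ^ c₂ + m := by omega
      _ ≤ m ^ c₂ * m + m ^ c₂ * m := by nlinarith
      _ = 2 * m ^ (c₂ + 1) := by ring
      _ ≤ m * m ^ (c₂ + 1) := Nat.mul_le_mul_right _ hm2
      _ = m ^ (c₂ + 2) := by ring
  calc (m ^ c₂ + n + 2) ^ c₃ ≤ (m ^ (c₂ + 2)) ^ c₃ := Nat.pow_le_pow_left h1 _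
    _ = m ^ ((c₂ + 2) * c₃) := by rw [← pow_mul]

/-- **L = S2″ ∘ S3″**: size-`t` proofs of all invariance identities give (S2″) a circuit `C'` for
`Ĉ` of size `≤ (|C| + t + n + 2)^{c₂}` whose unfoldings are invariant up to associativity and
commutativity, and whose AC-canonical form (S3″) is an `S_n`-symmetric circuit of size
`≤ (|C'| + n + 2)^{c₃} ≤ (|C| + t + n + 2)^{(c₂+2)c₃}`. [folklore] -/
theorem stabilityOfProvableSymmetry_of :
    Registered.stub_proofsToACEquiv → Registered.stub_stabilityAtACEquiv →
      StabilityOfProvableSymmetry := by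
  rintro ⟨c₂, h₂⟩ ⟨c₃, h₃⟩
  refine ⟨(c₂ + 2) * c₃, fun n t C hC => ?_⟩
  obtain ⟨C', hC'eval, hC'size, hC'pf⟩ := h₂ n t C hC
  obtain ⟨G, hG, D, hDsym, hDeval, hDcard⟩ := h₃ n C' hC'pf
  refine ⟨G, hG, D, hDsym, hDeval.trans hC'eval, ?_⟩
  calc Fintype.card G ≤ (C'.size + n + 2) ^ c₃ := hDcard
    _ ≤ ((C.size + t + n + 2) ^ c₂ + n + 2) ^ c₃ :=
        Nat.pow_le_pow_left (by omega) _
    _ ≤ (C.size + t + n + 2) ^ ((c₂ + 2) * c₃) := poly_absorb c₂ c₃ _ t n C.one_le_size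

/-- Size bookkeeping of the birth composition: with `M = (log₂ n + c₁)^c₁`,
`(2^M + 2^M + n + 2)^c₂ ≤ 2^((log₂ n + c)^c)` for `c = c₁ + c₂ + 3` and every `n`. [folklore] -/
theorem qp_absorb (c₁ c₂ : ℕ) : ∃ c : ℕ, ∀ n : ℕ,
    (2 ^ ((Nat.log 2 n + c₁) ^ c₁) + 2 ^ ((Nat.log 2 n + c₁) ^ c₁) + n + 2) ^ c₂ ≤
      2 ^ ((Nat.log 2 n + c) ^ c) := by
  refine ⟨c₁ + c₂ + 3, fun n => ?_⟩
  have hn : n < 2 ^ (Nat.log 2 n + 1) := Nat.lt_pow_succ_log_self Nat.one_lt_two n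
  generalize Nat.log 2 n = L at hn ⊢
  set M : ℕ := (L + c₁) ^ c₁ with hM
  set B : ℕ := L + (c₁ + c₂ + 3) with hB
  -- the base: `2^M + 2^M + n + 2 ≤ 2^(M + L + 3)`
  have h1 : 2 ^ M + 2 ^ M + n + 2 ≤ 2 ^ (M + L + 3) := by
    have hA : 2 ^ M ≤ 2 ^ (M + L + 1) := Nat.pow_le_pow_right (by norm_num) (by omega)
    have hL1 : 2 ^ (L + 1) ≤ 2 ^ (M + L + 1) := Nat.pow_le_pow_right (by norm_num) (by omega)
    have h4 : 2 ^ (M + L + 3) = 2 ^ (M + L + 1) * 4 := by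
      rw [show M + L + 3 = (M + L + 1) + 2 by omega, pow_add]; norm_num
    have hone : 1 ≤ 2 ^ (L + 1) := Nat.one_le_two_pow
    omega
  -- the exponent: `(M + L + 3) * c₂ ≤ B ^ (c₁ + c₂ + 3)`
  have h2 : (M + L + 3) * c₂ ≤ B ^ (c₁ + c₂ + 3) := by
    have hB1 : 1 ≤ B := by omega
    have hB2 : 2 ≤ B := by omega
    have hMB : M ≤ B ^ (c₁ + c₂ + 1) :=
      calc M = (L + c₁) ^ c₁ := hM
        _ ≤ B ^ c₁ := Nat.pow_le_pow_left (by omega) _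
        _ ≤ B ^ (c₁ + c₂ + 1) := Nat.pow_le_pow_right hB1 (by omega)
    have hLB : L + 3 ≤ B ^ (c₁ + c₂ + 1) :=
      calc L + 3 ≤ B := by omega
        _ = B ^ 1 := (pow_one B).symm
        _ ≤ B ^ (c₁ + c₂ + 1) := Nat.pow_le_pow_right hB1 (by omega)
    have hc₂B : c₂ ≤ B := by omega
    calc (M + L + 3) * c₂ ≤ (2 * B ^ (c₁ + c₂ + 1)) * B := Nat.mul_le_mul (by omega) hc₂B
      _ ≤ (B * B ^ (c₁ + c₂ + 1)) * B := Nat.mul_le_mul_right _ (Nat.mul_le_mul_right _ hB2)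
      _ = B ^ (c₁ + c₂ + 3) := by ring
  calc (2 ^ M + 2 ^ M + n + 2) ^ c₂ ≤ (2 ^ (M + L + 3)) ^ c₂ := Nat.pow_le_pow_left h1 _
    _ = 2 ^ ((M + L + 3) * c₂) := (pow_mul 2 _ _).symm
    _ ≤ 2 ^ (B ^ (c₁ + c₂ + 3)) := Nat.pow_le_pow_right (by norm_num) h2

/-- **Birth composition**: provability (T_gen) and stability (L) give symmetry restoration at
quasi-polynomial total cost. [folklore] -/
theorem restorationQP_of_T_L : InvarianceProvableQP → StabilityOfProvableSymmetry → RestorationQP := by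
  intro hT hL f hinv hVP
  obtain ⟨c₁, hc₁⟩ := hT f hinv hVP
  obtain ⟨c₂, hc₂⟩ := hL
  obtain ⟨c, hc⟩ := qp_absorb c₁ c₂
  refine ⟨c, fun n => ?_⟩
  obtain ⟨C, hCeval, hCsize, hCproofs⟩ := hc₁ n
  obtain ⟨G, hG, D, hDsym, hDeval, hDcard⟩ :=
    hc₂ n (2 ^ ((Nat.log 2 n + c₁) ^ c₁)) C hCproofs
  refine ⟨G, hG, D, hDsym, ?_, ?_⟩
  · rw [hDeval, hCeval]
  · calc Fintype.card G ≤ (C.size + 2 ^ ((Nat.log 2 n + c₁) ^ c₁) + n + 2) ^ c₂ := hDcard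
      _ ≤ (2 ^ ((Nat.log 2 n + c₁) ^ c₁) + 2 ^ ((Nat.log 2 n + c₁) ^ c₁) + n + 2) ^ c₂ :=
          Nat.pow_le_pow_left (by omega) _
      _ ≤ 2 ^ ((Nat.log 2 n + c) ^ c) := hc n

/-- **S2⁗ ⇒ S2″** (cycle 2, PROVED by worker A): unfoldings invariant up to AC + units + constants give,
through the normalised AC-canonical symmetric circuit (S3⁗) and its straight-line layout (B-core″), a
poly-larger circuit with AC-invariant unfoldings (`Theorems.proofsToACEquiv_of_proofsToDistEquiv`). [folklore] -/
theorem proofsToACEquiv_of_dist : Registered.stub_proofsToDistEquiv → Registered.stub_proofsToACEquiv :=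
  fun h => Summit.ValiantsHypothesis.ValiantsHypothesis.Theorems.proofsToACEquiv_of_proofsToDistEquiv h

/-- **L = S2⁗ ∘ S3⁗** directly (cycle 2): the distributivity-free form of the stability pair composes to
the birth stub L exactly as S2″ ∘ S3″ did. [folklore] -/
theorem stabilityOfProvableSymmetry_of_dist :
    Registered.stub_proofsToDistEquiv → Registered.stub_stabilityAtDistEquiv →
      StabilityOfProvableSymmetry := by
  rintro ⟨c₂, h₂⟩ ⟨c₃, h₃⟩
  refine ⟨(c₂ + 2) * c₃, fun n t C hC => ?_⟩
  obtain ⟨C', hC'eval, hC'size, hC'pf⟩ := h₂ n t C hC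
  obtain ⟨G, hG, D, hDsym, hDeval, hDcard⟩ := h₃ n C' hC'pf
  refine ⟨G, hG, D, hDsym, hDeval.trans hC'eval, ?_⟩
  calc Fintype.card G ≤ (C'.size + n + 2) ^ c₃ := hDcard
    _ ≤ ((C.size + t + n + 2) ^ c₂ + n + 2) ^ c₃ :=
        Nat.pow_le_pow_left (by omega) _
    _ ≤ (C.size + t + n + 2) ^ ((c₂ + 2) * c₃) := poly_absorb c₂ c₃ _ t n C.one_le_size

/-- **Cycle 4: the line at distributivity budget zero is a theorem** — restoration AND proof-carrying
symmetry for every circuit whose renamed unfoldings are inter-derivable with its unfolding without A6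
(`Theorems.proofCarryingSymmetry_at_distBudgetZero`, p166162). [folklore] -/
theorem line_at_distBudgetZero : ∃ c : ℕ, ∀ (n : ℕ) (C : PICircuit ℂ (Fin n × Fin n)),
    (∀ σ : Equiv.Perm (Fin n),
      (pfSystem ℂ (Fin n × Fin n)).Provable (C.rename fun x : Fin n × Fin n => σ • x).unfold
        C.unfold ⊤ (fun s => if s = PIAxiom.A6 then 0 else ⊤)) →
    (∃ (G : Type) (_ : Fintype G) (D : LabelledArithCircuit ℂ (Fin n × Fin n) Unit G),
      D.IsSymmetric (Equiv.Perm (Fin n)) ∧ D.eval (D.output ()) = C.eval ∧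
      Fintype.card G ≤ (C.size + n + 2) ^ c) ∧
    ∃ C' : PICircuit ℂ (Fin n × Fin n), C'.eval = C.eval ∧ C'.size ≤ (C.size + n + 2) ^ c ∧
      (∀ σ : Equiv.Perm (Fin n),
        Summit.ValiantsHypothesis.ValiantsHypothesis.Theorems.ACStability.ACEq
          (C'.rename fun x : Fin n × Fin n => σ • x).unfold C'.unfold) ∧
      ∀ σ : Equiv.Perm (Fin n),
        HasPCProofOfSize (C'.rename fun x : Fin n × Fin n => σ • x) C' ((C.size + n + 2) ^ c) :=
  Summit.ValiantsHypothesis.ValiantsHypothesis.Theorems.proofCarryingSymmetry_at_distBudgetZero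

/-- **Cycle 4: the crux implies the WIDTH LAW** for diagonally invariant VP families (polylog counting
width, uniformly in `n`; `Theorems.widthLawVP_of_restorationQP`, p166528), and the width law alone already
implies `VP ≠ VNP` (`Theorems.valiantsHypothesis_of_widthLawVP`). [folklore] -/
theorem widthLawVP_of_crux (hR : RestorationQP) :
    ∀ f : (n : ℕ) → MvPolynomial (Fin n × Fin n) ℂ,
      (∀ (n : ℕ) (σ : Equiv.Perm (Fin n)),
        MvPolynomial.rename (fun x : Fin n × Fin n => σ • x) (f n) = f n) →
      IsVPFamily f →
      ∃ c' : ℕ, ∀ (n : ℕ) (X Y : SimpleGraph (Fin n)),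
        Literature.ModelTheory.FiniteModelTheory.CkEquiv ((Nat.log 2 n + c') ^ c') X Y →
        MvPolynomial.eval (Set.indicator {ij : Fin n × Fin n | X.Adj ij.1 ij.2} 1) (f n) =
          MvPolynomial.eval (Set.indicator {ij : Fin n × Fin n | Y.Adj ij.1 ij.2} 1) (f n) :=
  Summit.ValiantsHypothesis.ValiantsHypothesis.Theorems.widthLawVP_of_restorationQP hR

/-- **Cycle 5: the rung S3^(1)-inv — stability at distributivity budget ONE for one invariant generic
instance** (`Theorems.stabilityAtDistOne_invariantGeneric`, p171250; the first case of c4's CORE(1),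
`Theorems.stabilityAtDistOne_of_core`).  If ONE ground distributivity instance `e : P·(Q+R) = P·Q + P·R`,
generic (each of `P, Q, R` keeps a variable after constant folding) and `S_n`-invariant modulo the
distributivity-free fragment, makes `(C∘σ)•` and `C•` congruent (`ACStability.UCEqWith e`) for every
`σ`, then an `S_n`-symmetric circuit of size `≤ (|C|+n+2)^c` computes `Ĉ` — by the SEMANTIC
CHURCH–ROSSER theorem `Theorems.esat_acEq_of_ucEqWith` (the e-saturation `ACStability.esat` is a
homomorphism into e-saturated constant-normal forms), equivariance `Theorems.esat_rename`, and lead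
c1's AC-canonical circuit of the saturated class (`ACStability.esatClass`), which every `σ` fixes.
[folklore] -/
theorem rung_distOne_invariantGeneric : ∃ c : ℕ, ∀ (n : ℕ) (C : PICircuit ℂ (Fin n × Fin n))
    (d : Summit.ValiantsHypothesis.ValiantsHypothesis.Theorems.ACStability.DistData ℂ (Fin n × Fin n)),
    d.Generic →
    (∀ σ : Equiv.Perm (Fin n),
      Summit.ValiantsHypothesis.ValiantsHypothesis.Theorems.ACStability.UCEq
          (d.P.rename fun x : Fin n × Fin n => σ • x) d.P ∧
        Summit.ValiantsHypothesis.ValiantsHypothesis.Theorems.ACStability.UCEq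
          (d.Q.rename fun x : Fin n × Fin n => σ • x) d.Q ∧
        Summit.ValiantsHypothesis.ValiantsHypothesis.Theorems.ACStability.UCEq
          (d.R.rename fun x : Fin n × Fin n => σ • x) d.R) →
    (∀ σ : Equiv.Perm (Fin n),
      Summit.ValiantsHypothesis.ValiantsHypothesis.Theorems.ACStability.UCEqWith d.eqn
        (C.rename fun x : Fin n × Fin n => σ • x).unfold C.unfold) →
    ∃ (G : Type) (_ : Fintype G) (D : LabelledArithCircuit ℂ (Fin n × Fin n) Unit G),
      D.IsSymmetric (Equiv.Perm (Fin n)) ∧ D.eval (D.output ()) = C.eval ∧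
      Fintype.card G ≤ (C.size + n + 2) ^ c :=
  Summit.ValiantsHypothesis.ValiantsHypothesis.Theorems.stabilityAtDistOne_invariantGeneric

/-- **Cycle 5: the μ-lemma — an INERT generic instance buys nothing at budget one**
(`Theorems.stabilityAtDistOne_of_inert`, p170929, no invariance hypothesis): if the e-saturation does not touch
`cnorm C•` then budget-one congruence for all `σ` already gives an `S_n`-symmetric circuit of size
`≤ (|C|+n+2)^c` (the e-saturation of a normal form fixes it or strictly increases its leaf count,
`ACStability.esat_rigid`). [folklore] -/
theorem rung_distOne_inert : ∃ c : ℕ, ∀ (n : ℕ) (C : PICircuit ℂ (Fin n × Fin n))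
    (d : Summit.ValiantsHypothesis.ValiantsHypothesis.Theorems.ACStability.DistData ℂ (Fin n × Fin n)),
    d.Generic →
    Summit.ValiantsHypothesis.ValiantsHypothesis.Theorems.ACStability.esat d
        (Summit.ValiantsHypothesis.ValiantsHypothesis.Theorems.ACStability.cnorm C.unfold) =
      Summit.ValiantsHypothesis.ValiantsHypothesis.Theorems.ACStability.cnorm C.unfold →
    (∀ σ : Equiv.Perm (Fin n),
      Summit.ValiantsHypothesis.ValiantsHypothesis.Theorems.ACStability.UCEqWith d.eqn
        (C.rename fun x : Fin n × Fin n => σ • x).unfold C.unfold) →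
    ∃ (G : Type) (_ : Fintype G) (D : LabelledArithCircuit ℂ (Fin n × Fin n) Unit G),
      D.IsSymmetric (Equiv.Perm (Fin n)) ∧ D.eval (D.output ()) = C.eval ∧
      Fintype.card G ≤ (C.size + n + 2) ^ c :=
  Summit.ValiantsHypothesis.ValiantsHypothesis.Theorems.stabilityAtDistOne_of_inert

/-- **Composition** (the glue of the reshaped line, kernel-checked): with W1 landed
(`stub_vpFamily_piCircuit`, p145664) and S3⁗ landed (`stub_stabilityAtDistEquiv`, p157844),
T′ → S2⁗ → RestorationQP. [folklore] -/
theorem RestorationQP_of :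
    Registered.stub_invarianceProvableQP' → Registered.stub_proofsToDistEquiv → RestorationQP :=
  fun hT hS2 =>
    restorationQP_of_T_L (invarianceProvableQP_of stub_vpFamily_piCircuit hT)
      (stabilityOfProvableSymmetry_of_dist hS2 stub_stabilityAtDistEquiv)

/-- Wiring check: the registered stubs feed `RestorationQP_of` exactly as stated, so the skeleton
is `RestorationQP` closed modulo the two open conjecture-grade stubs T′ (proven NECESSARY) and S2⁗
(the bet, ≡ L) — sorries enter only through them. -/
example : RestorationQP :=
  RestorationQP_of stub_invarianceProvableQP' stub_proofsToDistEquiv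

end Summit.ValiantsHypothesis.ValiantsHypothesis.Cruxes.RestorationQP.Birth
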